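import Mathlib.Algebra.BigOperators.Pi
import Mathlib.Algebra.BigOperators.Ring.Finset
import Mathlib.Algebra.Order.BigOperators.Group.Finset
import Mathlib.Algebra.Group.Pi.Lemmas
import Mathlib.Data.Finset.SymmDiff
import Mathlib.Data.Fintype.Pi
import Mathlib.Order.SymmDiff
import Mathlib.Tactic.Abel
import Mathlib.Tactic.Linarith
import Mathlib.Tactic.Push
import Mathlib.Tactic.Ring
import HarnessLib

/-!
# Rivasseau's lemma on balanced subgraphs of a directed multigraph

V. Rivasseau, *Lieb's correlation inequality for plane rotors*, Comm. Math. Phys. **77** (1980) 145–147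
[Rivasseau1980], Lemma (§I), proving (in a slightly stronger form) the conjecture of E. H. Lieb, *A refinement of
Simon's correlation inequality*, Comm. Math. Phys. **77** (1980) 127–135 [Lieb1980], p. 133.

Let `G` be a finite directed graph, several arrows between two vertices and loops allowed; here: a finite set `E`
of arrow names and an endpoint map `d : ε → V × V`, `d e = (tail, head)`. The VALENCE of a set of arrows `S` at a
vertex `x` is the number of arrows of `S` into `x` minus the number out of `x` (`valence d S x`; as a function on
`V` it is the sum of the arrow charges `e_head − e_tail`, `arrowCharge`). Let `m = valence d E` be the valence of the
whole graph and suppose `m v > 0`. Rivasseau's Lemma: the number of BALANCED subgraphs (subsets `S ⊆ E` with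
valence `0` at every vertex, the empty one included) is at most the number of subsets `S ⊆ E` whose valence is `+1`
at `v`, `−1` at some vertex `x` with `m x < 0`, and `0` elsewhere (`card_balanced_le_card_transport`). The proof is
Rivasseau's: induction on the number of arrows; for an arrow INTO `v` from `u`, either `m u < 0` and `S ↦ S ∪ {arrow}`
injects, or the arrow is deleted and the induction hypothesis is applied at `u`; for an arrow OUT of `v` contained in
some balanced subgraph `L`, reversing the arrows of `L` (which preserves all valences of `E` and, through
`S ↦ S ∆ L`, the two counts) reduces to the previous case; finally a double count over the arrows at `v`
(`p · #balanced ≤ (q + 1) · #transport` with `p − q = m v ≥ 1` the numbers of arrows into / out of `v`).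

Consumer form (`card_balanced_le_sum_card`): if every vertex of negative valence lies in a set `B`, the number of
balanced subgraphs is at most `∑_{b ∈ B} #{S ⊆ E : valence S = e_v − e_b}` — the shape used in Lieb's plane-rotor
inequality (Lieb 1980 (23), `PlaneRotator.LiebRivasseauInequality`), where the arrows are the oriented Taylor factors
of the Gibbs weight of the inside system.

Elementary finite combinatorics; no measure theory. Not here: the application to rotors (separate files).
-/

namespace Literature.Combinatorics.Digraph

open Finset
open scoped symmDiff

/-! ### Arrow charges and valences -/

section Valence

variable {V : Type*} [DecidableEq V] {ε : Type*}

/-- The charge of an arrow `p = (tail, head)`: the function `e_head − e_tail` on vertices (`+1` at the head, `−1`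
at the tail, `0` for a loop). [cite: Rivasseau1980, Lemma (valence: arrows in minus arrows out)] -/
def arrowCharge (p : V × V) : V → ℤ :=
  Pi.single p.2 1 - Pi.single p.1 1

/-- Pointwise form of the arrow charge. [cite: Rivasseau1980, Lemma (valence: arrows in minus arrows out)] -/
theorem arrowCharge_apply (p : V × V) (x : V) :
    arrowCharge p x = (if p.2 = x then 1 else 0) - (if p.1 = x then 1 else 0) := by
  simp only [arrowCharge, Pi.sub_apply, Pi.single_apply, @eq_comm _ x]

/-- Reversing an arrow negates its charge. [cite: Rivasseau1980, Lemma (proof: reversing arrows)] -/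
theorem arrowCharge_swap (p : V × V) : arrowCharge p.swap = -arrowCharge p := by
  unfold arrowCharge
  rw [Prod.fst_swap, Prod.snd_swap, neg_sub]

/-- The **valence** of a set of arrows `S` (endpoint map `d`): the function on vertices
`x ↦ #{arrows of S into x} − #{arrows of S out of x}`, i.e. the sum of the arrow charges.
[cite: Rivasseau1980, Lemma (valence at a vertex)] -/
def valence (d : ε → V × V) (S : Finset ε) : V → ℤ :=
  ∑ e ∈ S, arrowCharge (d e)

/-- Pointwise form of the valence. [cite: Rivasseau1980, Lemma (valence at a vertex)] -/
theorem valence_apply (d : ε → V × V) (S : Finset ε) (x : V) :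
    valence d S x = ∑ e ∈ S, arrowCharge (d e) x := by
  unfold valence
  exact Finset.sum_apply _ _ _

/-- The valence at `x` is the number of arrows into `x` minus the number of arrows out of `x`. [cite: Rivasseau1980, Lemma (valence at a vertex)] -/
theorem valence_apply_eq_card_sub_card (d : ε → V × V) (S : Finset ε) (x : V) :
    valence d S x = ((S.filter fun e => (d e).2 = x).card : ℤ) - ((S.filter fun e => (d e).1 = x).card : ℤ) := by
  rw [valence_apply]
  simp only [arrowCharge_apply, Finset.sum_sub_distrib, Finset.sum_boole]

/-- The empty set of arrows has valence `0` (the empty graph is balanced). [cite: Rivasseau1980, Lemma (N(G) includes the empty graph)] -/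
@[simp] theorem valence_empty (d : ε → V × V) : valence d ∅ = 0 := by
  simp [valence]

variable [DecidableEq ε]

/-- Adding an arrow adds its charge. [cite: Rivasseau1980, Lemma (proof: S ↦ S ∪ {l_j})] -/
theorem valence_insert (d : ε → V × V) {e : ε} {S : Finset ε} (h : e ∉ S) :
    valence d (insert e S) = arrowCharge (d e) + valence d S := by
  unfold valence
  exact Finset.sum_insert h

/-- Valences are additive over a set and its complement. [cite: Rivasseau1980, Lemma (valence of subgraphs)] -/
theorem valence_add_valence_sdiff (d : ε → V × V) {S E : Finset ε} (h : S ⊆ E) :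
    valence d S + valence d (E \ S) = valence d E := by
  unfold valence
  rw [add_comm]
  exact Finset.sum_sdiff h

/-- Valences are additive over `S ∩ L` and `S \ L`. [cite: Rivasseau1980, Lemma (valence of subgraphs)] -/
theorem valence_inter_add_valence_sdiff (d : ε → V × V) (S L : Finset ε) :
    valence d (S ∩ L) + valence d (S \ L) = valence d S := by
  unfold valence
  exact Finset.sum_inter_add_sum_sdiff S L _

/-! ### Reversing the arrows of a subgraph -/

/-- The endpoint map obtained by reversing the arrows of `L` (Rivasseau's graph `G^L`). [cite: Rivasseau1980, Lemma (proof: reversal of the arrows of a balanced subgraph)] -/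
def reverseOn (d : ε → V × V) (L : Finset ε) (e : ε) : V × V :=
  if e ∈ L then (d e).swap else d e

/-- Valence after reversal: `valence_{G^L}(S) = valence(S \ L) − valence(S ∩ L)`. [cite: Rivasseau1980, Lemma (proof: the graph G^L)] -/
theorem valence_reverseOn (d : ε → V × V) (L S : Finset ε) :
    valence (reverseOn d L) S = valence d (S \ L) - valence d (S ∩ L) := by
  unfold valence
  rw [← Finset.sum_inter_add_sum_sdiff S L, sub_eq_add_neg, add_comm, ← Finset.sum_neg_distrib]
  congr 1
  · exact Finset.sum_congr rfl fun e he => by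
      rw [reverseOn, if_neg (Finset.mem_sdiff.1 he).2]
  · exact Finset.sum_congr rfl fun e he => by
      rw [reverseOn, if_pos (Finset.mem_inter.1 he).2, arrowCharge_swap]

/-- Reversing the arrows of `L ⊆ E` changes the valence of `E` by `−2 · valence L`; in particular a BALANCED `L`
leaves all valences of `E` unchanged. [cite: Rivasseau1980, Lemma (proof: "the valences mᵢ do not change")] -/
theorem valence_reverseOn_of_subset (d : ε → V × V) {L E : Finset ε} (h : L ⊆ E) :
    valence (reverseOn d L) E = valence d E - 2 • valence d L := by
  rw [valence_reverseOn, Finset.inter_eq_right.2 h, ← valence_add_valence_sdiff d h, two_nsmul]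
  abel

/-- The key identity behind Rivasseau's bijection `S ↦ S ∆ L`:
`valence_{G^L}(S ∆ L) = valence_G(S) − valence_G(L)`. [cite: Rivasseau1980, Lemma (proof: bijections S ↦ S Δ L)] -/
theorem valence_reverseOn_symmDiff (d : ε → V × V) (L S : Finset ε) :
    valence (reverseOn d L) (S ∆ L) = valence d S - valence d L := by
  rw [valence_reverseOn]
  have h1 : (S ∆ L) \ L = S \ L := by
    ext e
    simp only [Finset.mem_sdiff, Finset.mem_symmDiff]
    tauto
  have h2 : (S ∆ L) ∩ L = L \ S := by
    ext e
    simp only [Finset.mem_inter, Finset.mem_symmDiff, Finset.mem_sdiff]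
    tauto
  rw [h1, h2, ← valence_inter_add_valence_sdiff d S L, ← valence_inter_add_valence_sdiff d L S,
    Finset.inter_comm L S]
  abel

/-! ### Orienting a family of pairs by signs -/

/-- The arrows obtained from a family of pairs `g i = (x_i, y_i)` and signs `σ`: the pair as it stands when
`σ i = true`, reversed when `σ i = false` (in the application: the two exponentials `e^{±i(θ_y − θ_x)}` of a Taylor
factor `cos(θ_y − θ_x)`). [cite: Lieb1980, p. 133 (directed graphs from the expansion)] -/
def orient {α : Type*} (g : α → V × V) (σ : α → Bool) (i : α) : V × V :=
  if σ i then g i else (g i).swap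

/-- The charge of an oriented pair is `±` the charge of the pair. [cite: Lieb1980, p. 133 (directed graphs from the expansion)] -/
theorem arrowCharge_orient {α : Type*} (g : α → V × V) (σ : α → Bool) (i : α) :
    arrowCharge (orient g σ i) = if σ i then arrowCharge (g i) else -arrowCharge (g i) := by
  unfold orient
  split_ifs
  · rfl
  · exact arrowCharge_swap _

/-- The valence of an oriented family is the signed sum of the pair charges. [cite: Lieb1980, p. 133 (directed graphs from the expansion)] -/
theorem valence_orient {α : Type*} (g : α → V × V) (σ : α → Bool) (S : Finset α) :
    valence (orient g σ) S = ∑ i ∈ S, if σ i then arrowCharge (g i) else -arrowCharge (g i) := by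
  unfold valence
  exact Finset.sum_congr rfl fun i _ => arrowCharge_orient g σ i

/-- Flipping every sign negates every valence. [cite: Lieb1980, p. 133 (directed graphs from the expansion)] -/
theorem valence_orient_not {α : Type*} (g : α → V × V) (σ : α → Bool) (S : Finset α) :
    valence (orient g fun i => !σ i) S = -valence (orient g σ) S := by
  rw [valence_orient, valence_orient, ← Finset.sum_neg_distrib]
  refine Finset.sum_congr rfl fun i _ => ?_
  cases σ i <;> simp

end Valence

/-! ### Rivasseau's Lemma -/

section Rivasseau

variable {V : Type*} [Fintype V] [DecidableEq V] {ε : Type*}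

/-- The balanced subgraphs of `E` (valence `0` at every vertex), Rivasseau's `N(G)`. [cite: Rivasseau1980, Lemma (the set N(G))] -/
def balanced (d : ε → V × V) (E : Finset ε) : Finset (Finset ε) :=
  E.powerset.filter fun S => valence d S = 0

/-- The subgraphs of `E` with valence `+1` at `v`, `−1` at some vertex of negative total valence, `0` elsewhere:
Rivasseau's `K(M₁, G)`. [cite: Rivasseau1980, Lemma (the set K(M₁,G))] -/
def transport (d : ε → V × V) (E : Finset ε) (v : V) : Finset (Finset ε) :=
  E.powerset.filter fun S => ∃ x, valence d E x < 0 ∧ valence d S = Pi.single v 1 - Pi.single x 1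

/-- Membership in `balanced`. [cite: Rivasseau1980, Lemma (the set N(G))] -/
theorem mem_balanced {d : ε → V × V} {E S : Finset ε} : S ∈ balanced d E ↔ S ⊆ E ∧ valence d S = 0 := by
  rw [balanced, Finset.mem_filter, Finset.mem_powerset]

/-- Membership in `transport`. [cite: Rivasseau1980, Lemma (the set K(M₁,G))] -/
theorem mem_transport {d : ε → V × V} {E S : Finset ε} {v : V} :
    S ∈ transport d E v ↔ S ⊆ E ∧ ∃ x, valence d E x < 0 ∧ valence d S = Pi.single v 1 - Pi.single x 1 := by
  rw [transport, Finset.mem_filter, Finset.mem_powerset]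

/-- Double counting: `∑_{S ∈ 𝒮} #{e ∈ T : P e S} = ∑_{e ∈ T} #{S ∈ 𝒮 : P e S}`. [folklore] -/
private theorem sum_card_filter_comm (𝒮 : Finset (Finset ε)) (T : Finset ε) (P : ε → Finset ε → Prop)
    [∀ e S, Decidable (P e S)] :
    ∑ S ∈ 𝒮, (T.filter fun e => P e S).card = ∑ e ∈ T, (𝒮.filter fun S => P e S).card := by
  simp only [Finset.card_filter]
  exact Finset.sum_comm

variable [DecidableEq ε]

/-- `insert j` is injective on sets not containing `j`. [folklore] -/
private theorem insert_injOn (j : ε) {𝒮 : Finset (Finset ε)} (h : ∀ S ∈ 𝒮, j ∉ S) :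
    Set.InjOn (fun S : Finset ε => insert j S) ↑𝒮 := by
  intro S hS S' hS' hSS'
  have := congrArg (fun T : Finset ε => T.erase j) hSS'
  simpa only [Finset.erase_insert (h S hS), Finset.erase_insert (h S' hS')] using this

/-- Rivasseau's claim (5) for an arrow `j` INTO `v` (from `u`): `#{S ∈ N : j ∉ S} ≤ #{S ∈ K : j ∈ S}` — if the total
valence at `u` is negative, `S ↦ S ∪ {j}` injects; otherwise delete `j` and use the induction hypothesis at `u`.
[cite: Rivasseau1980, Lemma (proof of (5), case 1 ≤ j ≤ p)] -/
private theorem claim_in {n : ℕ}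
    (ih : ∀ (E' : Finset ε) (d' : ε → V × V) (v' : V), E'.card < n → 0 < valence d' E' v' →
      (balanced d' E').card ≤ (transport d' E' v').card)
    {E : Finset ε} (hE : E.card = n) {d : ε → V × V} {v : V} (hv : 0 < valence d E v)
    {j : ε} (hj : j ∈ E) (hjv : (d j).2 = v) :
    ((balanced d E).filter fun S => j ∉ S).card ≤ ((transport d E v).filter fun S => j ∈ S).card := by
  set u := (d j).1 with hu
  have hcharge : arrowCharge (d j) = Pi.single v 1 - Pi.single u 1 := by
    rw [arrowCharge, hjv]
  by_cases hneg : valence d E u < 0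
  · -- `S ↦ S ∪ {j}` injects
    refine Finset.card_le_card_of_injOn (fun S => insert j S) (fun S hS => ?_)
      (insert_injOn j fun S hS => (Finset.mem_filter.1 hS).2)
    simp only [Finset.mem_coe, Finset.mem_filter, mem_balanced, mem_transport] at hS ⊢
    obtain ⟨⟨hSE, hS0⟩, hjS⟩ := hS
    refine ⟨⟨Finset.insert_subset hj hSE, u, hneg, ?_⟩, Finset.mem_insert_self j S⟩
    rw [valence_insert d hjS, hS0, add_zero, hcharge]
  · -- delete `j`, induct at `u`
    push Not at hneg
    set E' := E.erase j with hE'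
    have hjE' : j ∉ E' := Finset.notMem_erase j E
    have hEE' : insert j E' = E := Finset.insert_erase hj
    have hcard : E'.card < n := by
      rw [hE', Finset.card_erase_of_mem hj, hE]
      have : 0 < n := by rw [← hE]; exact Finset.card_pos.2 ⟨j, hj⟩
      omega
    have hval : valence d E = arrowCharge (d j) + valence d E' := by
      rw [← hEE', valence_insert d hjE']
    have hvalx : ∀ x, valence d E x =
        ((if v = x then 1 else 0) - (if u = x then 1 else 0)) + valence d E' x := by
      intro x
      have := congrFun hval x
      rwa [Pi.add_apply, arrowCharge_apply, hjv, ← hu] at this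
    have hu' : 0 < valence d E' u := by
      have h1 := hvalx u
      by_cases huv : v = u
      · rw [if_pos huv, if_pos rfl] at h1
        rw [huv] at hv
        linarith
      · rw [if_neg huv, if_pos rfl] at h1
        linarith
    have hv' : 0 ≤ valence d E' v := by
      have h2 := hvalx v
      rw [if_pos rfl] at h2
      split_ifs at h2 <;> linarith
    have hih := ih E' d u hcard hu'
    have hL : ((balanced d E).filter fun S => j ∉ S) = balanced d E' := by
      ext S
      simp only [Finset.mem_filter, mem_balanced, hE', Finset.subset_erase]
      tauto
    rw [hL]
    refine hih.trans (Finset.card_le_card_of_injOn (fun S => insert j S) (fun S hS => ?_)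
      (insert_injOn j fun S hS => fun hjS => hjE' ((mem_transport.1 hS).1 hjS)))
    simp only [Finset.mem_coe, Finset.mem_filter, mem_transport] at hS ⊢
    obtain ⟨hSE', x, hx, hSx⟩ := hS
    have hjS : j ∉ S := fun h => hjE' (hSE' h)
    rw [hE', Finset.subset_erase] at hSE'
    refine ⟨⟨Finset.insert_subset hj hSE'.1, x, ?_, ?_⟩, Finset.mem_insert_self j S⟩
    · -- `x ≠ v`, so deleting `j` did not lower the valence at `x`
      have hxv : v ≠ x := fun h => by rw [← h] at hx; linarith
      have h3 := hvalx x
      rw [if_neg hxv] at h3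
      split_ifs at h3 <;> linarith
    · rw [valence_insert d hjS, hSx, hcharge]
      abel

/-- Rivasseau's claim (5) for an arrow `j` OUT of `v`: `#{S ∈ N : j ∈ S} ≤ #{S ∈ K : j ∉ S}` — if some balanced `L`
contains `j`, reverse the arrows of `L`; `S ↦ S ∆ L` matches both counts with those of the reversed graph, in which
`j` points INTO `v`. [cite: Rivasseau1980, Lemma (proof of (5), case p + 1 ≤ j ≤ p + q)] -/
private theorem claim_out {n : ℕ}
    (ih : ∀ (E' : Finset ε) (d' : ε → V × V) (v' : V), E'.card < n → 0 < valence d' E' v' →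
      (balanced d' E').card ≤ (transport d' E' v').card)
    {E : Finset ε} (hE : E.card = n) {d : ε → V × V} {v : V} (hv : 0 < valence d E v)
    {j : ε} (hj : j ∈ E) (hjv : (d j).1 = v) :
    ((balanced d E).filter fun S => j ∈ S).card ≤ ((transport d E v).filter fun S => j ∉ S).card := by
  by_cases h0 : ((balanced d E).filter fun S => j ∈ S) = ∅
  · rw [h0, Finset.card_empty]
    exact Nat.zero_le _
  obtain ⟨L, hL⟩ := Finset.nonempty_iff_ne_empty.2 h0
  rw [Finset.mem_filter, mem_balanced] at hL
  obtain ⟨⟨hLE, hL0⟩, hjL⟩ := hL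
  set d' := reverseOn d L with hd'
  have hvE : valence d' E = valence d E := by
    rw [hd', valence_reverseOn_of_subset d hLE, hL0, nsmul_zero, sub_zero]
  have hv' : 0 < valence d' E v := by
    rw [hvE]
    exact hv
  have hjv' : (d' j).2 = v := by
    rw [hd', reverseOn, if_pos hjL, Prod.snd_swap, hjv]
  have hsub : ∀ S, S ⊆ E → S ∆ L ⊆ E := fun S hS =>
    Finset.symmDiff_subset_union.trans (Finset.union_subset hS hLE)
  have hinj : ∀ 𝒮 : Finset (Finset ε), Set.InjOn (fun S : Finset ε => S ∆ L) ↑𝒮 :=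
    fun 𝒮 S _ S' _ h => symmDiff_left_injective L h
  calc ((balanced d E).filter fun S => j ∈ S).card
      ≤ ((balanced d' E).filter fun S => j ∉ S).card := by
        refine Finset.card_le_card_of_injOn (fun S => S ∆ L) (fun S hS => ?_) (hinj _)
        simp only [Finset.mem_coe, Finset.mem_filter, mem_balanced] at hS ⊢
        obtain ⟨⟨hSE, hS0⟩, hjS⟩ := hS
        refine ⟨⟨hsub S hSE, ?_⟩, fun h => ?_⟩
        · rw [hd', valence_reverseOn_symmDiff, hS0, hL0, sub_zero]
        · rw [Finset.mem_symmDiff] at h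
          tauto
    _ ≤ ((transport d' E v).filter fun S => j ∈ S).card := claim_in ih hE hv' hj hjv'
    _ ≤ ((transport d E v).filter fun S => j ∉ S).card := by
        refine Finset.card_le_card_of_injOn (fun S => S ∆ L) (fun T hT => ?_) (hinj _)
        simp only [Finset.mem_coe, Finset.mem_filter, mem_transport] at hT ⊢
        obtain ⟨⟨hTE, x, hx, hTx⟩, hjT⟩ := hT
        refine ⟨⟨hsub T hTE, x, by rwa [hvE] at hx, ?_⟩, fun h => ?_⟩
        · have := valence_reverseOn_symmDiff d L (T ∆ L)
          rw [symmDiff_symmDiff_cancel_right, hL0, sub_zero] at this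
          rw [← this, ← hd', hTx]
        · rw [Finset.mem_symmDiff] at h
          tauto

/-- For a subset `S ⊆ E`, the arrows of `E` into `x` lying in `S` are the arrows of `S` into `x`. [folklore] -/
private theorem filter_mem_eq {E S : Finset ε} (hSE : S ⊆ E) (P : ε → Prop) [DecidablePred P] :
    ((E.filter P).filter fun e => e ∈ S) = S.filter P := by
  ext e
  simp only [Finset.mem_filter]
  constructor
  · rintro ⟨⟨-, hP⟩, heS⟩
    exact ⟨heS, hP⟩
  · rintro ⟨heS, hP⟩
    exact ⟨⟨hSE heS, hP⟩, heS⟩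

/-- **Rivasseau's Lemma** (Rivasseau 1980, §I; Lieb's 1980 conjecture, p. 133, in a slightly stronger form). Let
`E` be a finite set of arrows with endpoints `d e = (tail, head)` on a finite vertex set (loops and multiple arrows
allowed) and let `v` be a vertex of positive total valence, `0 < valence d E v`. Then the number of balanced
subgraphs `S ⊆ E` (valence `0` everywhere, the empty subgraph included) is at most the number of subgraphs `S ⊆ E`
with valence `+1` at `v`, `−1` at some vertex `x` of negative total valence, and `0` at all other vertices:
`#N(G) ≤ #K(v, G)`. [cite: Rivasseau1980, Lemma (eq. (4))] -/
theorem card_balanced_le_card_transport (E : Finset ε) (d : ε → V × V) (v : V) (hv : 0 < valence d E v) :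
    (balanced d E).card ≤ (transport d E v).card := by
  -- strong induction on the number of arrows
  suffices H : ∀ (n : ℕ) (E : Finset ε) (d : ε → V × V) (v : V), E.card = n → 0 < valence d E v →
      (balanced d E).card ≤ (transport d E v).card from H _ E d v rfl hv
  intro n
  induction n using Nat.strong_induction_on with
  | _ n ih =>
  intro E d v hE hv
  have ih' : ∀ (E' : Finset ε) (d' : ε → V × V) (v' : V), E'.card < n → 0 < valence d' E' v' →
      (balanced d' E').card ≤ (transport d' E' v').card :=
    fun E' d' v' h h' => ih _ h E' d' v' rfl h'
  -- arrows into / out of `v`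
  set In := E.filter fun e => (d e).2 = v with hIn
  set Out := E.filter fun e => (d e).1 = v with hOut
  have hpq : valence d E v = (In.card : ℤ) - (Out.card : ℤ) := valence_apply_eq_card_sub_card d E v
  have hp : Out.card + 1 ≤ In.card := by
    have := hv
    rw [hpq] at this
    omega
  -- per-subgraph counts at `v`
  have hcountN : ∀ S ∈ balanced d E,
      (In.filter fun e => e ∉ S).card + (Out.filter fun e => e ∈ S).card = In.card := by
    intro S hS
    rw [mem_balanced] at hS
    have h1 := Finset.card_filter_add_card_filter_not (s := In) (fun e => e ∈ S)
    have h2 : (In.filter fun e => e ∈ S) = S.filter fun e => (d e).2 = v := filter_mem_eq hS.1 _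
    have h3 : (Out.filter fun e => e ∈ S) = S.filter fun e => (d e).1 = v := filter_mem_eq hS.1 _
    have h4 := valence_apply_eq_card_sub_card d S v
    rw [hS.2, Pi.zero_apply] at h4
    rw [h2] at h1
    rw [h3]
    omega
  have hcountK : ∀ S ∈ transport d E v,
      (In.filter fun e => e ∈ S).card + (Out.filter fun e => e ∉ S).card = Out.card + 1 := by
    intro S hS
    rw [mem_transport] at hS
    obtain ⟨hSE, x, hx, hSx⟩ := hS
    have hxv : x ≠ v := fun h => by rw [h] at hx; linarith
    have h1 := Finset.card_filter_add_card_filter_not (s := Out) (fun e => e ∈ S)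
    have h2 : (In.filter fun e => e ∈ S) = S.filter fun e => (d e).2 = v := filter_mem_eq hSE _
    have h3 : (Out.filter fun e => e ∈ S) = S.filter fun e => (d e).1 = v := filter_mem_eq hSE _
    have h4 := valence_apply_eq_card_sub_card d S v
    rw [hSx, Pi.sub_apply, Pi.single_apply, Pi.single_apply, if_pos rfl, if_neg hxv.symm] at h4
    rw [h3] at h1
    rw [h2]
    omega
  -- double counting over the arrows at `v`
  have hN : In.card * (balanced d E).card =
      ∑ e ∈ In, ((balanced d E).filter fun S => e ∉ S).card +
        ∑ e ∈ Out, ((balanced d E).filter fun S => e ∈ S).card := by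
    rw [← sum_card_filter_comm, ← sum_card_filter_comm, ← Finset.sum_add_distrib, mul_comm,
      Finset.card_eq_sum_ones (balanced d E), Finset.sum_mul]
    exact Finset.sum_congr rfl fun S hS => by rw [one_mul, hcountN S hS]
  have hK : ∑ e ∈ In, ((transport d E v).filter fun S => e ∈ S).card +
        ∑ e ∈ Out, ((transport d E v).filter fun S => e ∉ S).card =
      (Out.card + 1) * (transport d E v).card := by
    rw [← sum_card_filter_comm, ← sum_card_filter_comm, ← Finset.sum_add_distrib, mul_comm,
      Finset.card_eq_sum_ones (transport d E v), Finset.sum_mul]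
    exact Finset.sum_congr rfl fun S hS => by rw [one_mul, hcountK S hS]
  have hle : In.card * (balanced d E).card ≤ (Out.card + 1) * (transport d E v).card := by
    rw [hN, ← hK]
    refine add_le_add (Finset.sum_le_sum fun e he => ?_) (Finset.sum_le_sum fun e he => ?_)
    · exact claim_in ih' hE hv (Finset.mem_filter.1 he).1 (Finset.mem_filter.1 he).2
    · exact claim_out ih' hE hv (Finset.mem_filter.1 he).1 (Finset.mem_filter.1 he).2
  have hpos : 0 < In.card := by omega
  exact Nat.le_of_mul_le_mul_left (hle.trans (Nat.mul_le_mul_right _ hp)) hpos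

/-- **Rivasseau's Lemma, summed form.** If `0 < valence d E v` and every vertex of negative total valence belongs
to `B`, then the number of balanced subgraphs of `E` is at most `∑_{b ∈ B} #{S ⊆ E : valence S = e_v − e_b}` (the
sets `K(v, G) ∩ {valence = e_v − e_b}` are disjoint for distinct `b`). This is the form consumed by Lieb's inequality
(23) for plane rotors, where extra non-negative terms `b ∈ B` with `m b ≥ 0` are harmless (Lieb 1980, note after
(19): "the excess terms are nonnegative"). [cite: Rivasseau1980, Lemma (eq. (4)); Lieb1980 eq. (24)] -/
theorem card_balanced_le_sum_card (E : Finset ε) (d : ε → V × V) (v : V) (hv : 0 < valence d E v)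
    (B : Finset V) (hB : ∀ x, valence d E x < 0 → x ∈ B) :
    (balanced d E).card ≤
      ∑ b ∈ B, (E.powerset.filter fun S => valence d S = Pi.single v 1 - Pi.single b 1).card := by
  refine (card_balanced_le_card_transport E d v hv).trans ?_
  have hsub : transport d E v ⊆
      B.biUnion fun b => E.powerset.filter fun S => valence d S = Pi.single v 1 - Pi.single b 1 := by
    intro S hS
    rw [mem_transport] at hS
    obtain ⟨hSE, x, hx, hSx⟩ := hS
    rw [Finset.mem_biUnion]
    exact ⟨x, hB x hx, Finset.mem_filter.2 ⟨Finset.mem_powerset.2 hSE, hSx⟩⟩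
  exact (Finset.card_le_card hsub).trans Finset.card_biUnion_le

end Rivasseau

end Literature.Combinatorics.Digraph
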